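import Summits.QuantumFields.YangMills.Theses.FemtoCutoffLadder
import Summits.QuantumFields.YangMills.Theorems.FemtoCutoffLadderThinningAveraged
import Summits.QuantumFields.YangMills.Theorems.FemtoCutoffLadderSubOctaveBoundedUpStepMoments
import Summits.QuantumFields.YangMills.Theorems.FemtoCutoffLadderSubOctaveBoundedReshape
import Summits.QuantumFields.YangMills.Theorems.FemtoCutoffLadderDyadicNestedUpperOfBlockedExcitation
import Summits.QuantumFields.YangMills.Theorems.FemtoCutoffLadderDyadicNestedUpperDirichlet
import Summits.QuantumFields.YangMills.Theorems.LuscherReductionOneSiteLevelsIMS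
import Summits.QuantumFields.YangMills.Theorems.FemtoTransferGapEigenbasis
import Summits.QuantumFields.YangMills.Theorems.FemtoTransferGapGroundState

/-!
# FemtoCutoffLadder — the `UpStepEv` architecture glues (seat ym-idea-1 g5)

Route `route-QuantumFields-FemtoCutoffLadder`, items filed 2026-08-28 (rev 21):

* `UpStepEv` (stmt-QuantumFields-26796, crux r5) — the UPWARD incommensurable step in eventually form, VERBATIM the hypothesis `hU`
  of `CutoffLadder.femtoGapOfRecord_of_towerLadder_up`: the VARIATIONAL direction (the femto gap of the finer lattice at the next tower
  point `L_T ∈ (L, 2L)` is at most the gap at `L` plus `CΛ²`), asked for by the lead `ym-line-fcl-p1` (Cruxes/SubOctaveBounded/PICKED.md)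
  and `ym-line-fcl-p3` (RESHAPE.md);
* `PinnedUpStep` (stmt-QuantumFields-26925, crux r501; restated 1:1 from 26797 with the positive ground state) — its PINNED engine: the fine-translation AVERAGE of the thinning pull-back of the
  exact coarse eigen-ratio `φ'/Ω'`, time-`L` moments (critic idea-crit-4 P1 retype of `BlockedExcitationPersistence`: de-aliased, time-1 door);
* `Assembly3` (stmt-QuantumFields-26798) — `OctaveStepDecay → UpStepEv → CoarsePairScaling → OneSiteWindowAnchor → MatchedCouplingExists →
  FemtoGapOfRecord`.

This file proves, sorry-free: `Assembly3` (by the landed certificate), and `PinnedUpStep → UpStepEv` (pair by pair by the door argument of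
`UpStep.upStepAt_of_moments` run on the positive fine ground state, the trial vector being `ψ = f̄·Ω`; admissibility from `Dirichlet.ratio_multiplier`,
`Thinning.isPhys_avg_thin_shift` and `IsPhys.mul_of_invariant`, after two bridging identities between the tree vocabulary
(`Thinning.thin`, `torusConfigShift`) and the inline terms of the route item).  No summit and no crux is proved here.
-/

set_option autoImplicit false

noncomputable section

open MeasureTheory
open Literature.MathematicalPhysics.QuantumFieldTheory (Site Edge GaugeConfig torusConfigShift torusConfigShift_apply)
open Literature.MathematicalPhysics.QuantumLattice

namespace Summit.QuantumFields.YangMills.Theorems.FemtoCutoffLadder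

open Summit.QuantumFields.YangMills.Theorems.FemtoTransferGap
open Summit.QuantumFields.YangMills.Theses.FemtoCutoffLadder

/-- ★ **`Assembly3` holds**: the `UpStepEv` telescoping is exactly the landed certificate `CutoffLadder.femtoGapOfRecord_of_towerLadder_up`
(with the coarse pairs supplied by `coarsePairs_pow_of_coarsePairScaling`). [cite: LuscherWeiszWolff1991] -/
theorem assembly3_proof : Assembly3 :=
  fun h₁ hU h₃ h₄ h₅ => CutoffLadder.femtoGapOfRecord_of_towerLadder_up h₁ hU (coarsePairs_pow_of_coarsePairScaling h₃) h₄ h₅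

/-- **Bridging**: the thinning map `Thinning.thin L'` IS the inline straight-transporter map written in the item `PinnedUpStep`. [folklore] -/
theorem thin_eq_pinnedInline {L : ℕ} (L' : ℕ) (W : GaugeConfig 3 L SU2) :
    Thinning.thin L' W = fun e' : Edge 3 L' =>
      (List.ofFn fun t : Fin (if (e'.1 e'.2).val < L - L' then 2 else 1) =>
        W ((fun j => (((e'.1 j).val + min (e'.1 j).val (L - L') : ℕ) : ZMod L)) + Pi.single e'.2 ((t : ℕ) : ZMod L), e'.2)).prod := by
  funext e'
  exact transport_replicate_eq_prod_ofFn W _ e'.2 _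

/-- **Bridging**: the torus configuration shift `τ_v` IS the inline shift `U(· − v)` written in the item `PinnedUpStep`. [folklore] -/
theorem torusConfigShift_eq_pinnedInline {L : ℕ} (v : Site 3 L) (U : GaugeConfig 3 L SU2) :
    (torusConfigShift v U : GaugeConfig 3 L SU2) = fun e => U (e.1 - v, e.2) := by
  funext e
  exact torusConfigShift_apply v U e

/-- ★★ **The pinned engine glues**: `PinnedUpStep → UpStepEv`.  For each incommensurable pair the door argument of
`UpStep.upStepAt_of_moments` is run on the POSITIVE fine ground state `Ω ≥ c > 0` of `PhysL2.exists_groundState` with the trial vector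
`ψ = f̄·Ω`, `f̄` the fine-translation average of `(φ'/Ω') ∘ thin L'`, where `Ω' ≥ c' > 0` and `φ' ⊥ Ω'` are the exact coarse ground state and
first-excited physical eigenfunction (`PhysL2.exists_groundState`, `exists_isPhys_eigenseq`, `levelValue_one`, orthogonality by
`Dirichlet.l2_eq_zero_of_eigen_ne` + `secondValue_lt_topValue`); `ψ` is physical by `Dirichlet.ratio_multiplier`, `Thinning.isPhys_avg_thin_shift`
and `IsPhys.mul_of_invariant`; the re-centred vector `v = ψ − ⟨ψ,Ω⟩Ω` (`UpStep.recentred_moments`) is the Rayleigh trial vector, bounded above by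
`UpStep.l2_iterate_le_pow_secondValue`. [cite: ReedSimonIV1978, Thm. XIII.1] [cite: Luscher1983, §2] -/
theorem upStepEv_of_pinnedUpStep (h : PinnedUpStep) : UpStepEv := by
  obtain ⟨C, lam0, hlam0, H⟩ := h
  refine ⟨C, lam0, hlam0, fun lam hlam hle => ?_⟩
  obtain ⟨L0, HL⟩ := H lam hlam hle
  refine ⟨L0, fun L' _ L _ hL0 hlt hlt2 β β' hW hW' hm => ?_⟩
  have hLL : L' ≤ L := hlt.le
  have h2 : L ≤ 2 * L' := hlt2.le
  have hβ0 : 0 < β := zero_lt_one.trans_le hW.1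
  have hβ' : 0 < β' := zero_lt_one.trans_le hW'.1
  have hL1 : 1 ≤ L := NeZero.one_le
  set s : ℝ := C * luscherLambda β L ^ 2 with hsdef
  -- the POSITIVE fine ground state
  obtain ⟨Ω, θ, c, hΩ, hc, hcle, hΩ1, hΩeig, -, -, -⟩ := PhysL2.exists_groundState (L := L) β
  have hpos : ∀ U, 0 < Ω U := fun U => hc.trans_le (hcle U)
  -- coarse ground state `Ω' ≥ c' > 0` and first excited eigenfunction `φ'`
  obtain ⟨Ω', θ', c', hΩ', hc', hcle', hn', heig', -, -, -⟩ := PhysL2.exists_groundState (L := L') β'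
  obtain ⟨e, hon, heige, -, -⟩ := exists_isPhys_eigenseq (L := L') hβ'
  set φ' : GaugeConfig 3 L' SU2 → ℝ := ((e 1 : physSubmodule L') : GaugeConfig 3 L' SU2 → ℝ) with hφ'def
  have hφ' : IsPhys φ' := (e 1).2
  have hn1 : l2 φ' φ' = 1 := by have := hon 1 1; simpa using this
  have heig1 : transferApply β' φ' = secondValue su2Rep L' β' • φ' := by
    rw [← levelValue_one]; exact heige 1
  have horth : l2 φ' Ω' = 0 :=
    Dirichlet.l2_eq_zero_of_eigen_ne β' hφ' hΩ' heig1 heig' (PhysL2.secondValue_lt_topValue (L := L') β').ne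
  -- pointwise eigen-equations (route vocabulary)
  have heigp : ∀ U, ∫ V, transferKernel su2Rep β U V * Ω V ∂(configMeasure SU2 L) = topValue su2Rep L β * Ω U :=
    fun U => by simpa [transferApply] using congrFun hΩeig U
  have heigp' : ∀ U', ∫ V', transferKernel su2Rep β' U' V' * Ω' V' ∂(configMeasure SU2 L') = topValue su2Rep L' β' * Ω' U' :=
    fun U => by simpa [transferApply] using congrFun heig' U
  have heigp1 : ∀ U', ∫ V', transferKernel su2Rep β' U' V' * φ' V' ∂(configMeasure SU2 L') = secondValue su2Rep L' β' * φ' U' :=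
    fun U => by simpa [transferApply] using congrFun heig1 U
  -- the pinned statement at this pair
  have HB := HL L' L hL0 hlt hlt2 β β' hW hW' hm Ω hΩ hpos hΩ1 heigp Ω' hΩ' c' hc' hcle' hn' heigp' φ' hφ' horth hn1 heigp1
  simp only [] at HB
  obtain ⟨hvar, hineq⟩ := HB
  -- the ratio `φ'/Ω'` is physical on the coarse torus
  obtain ⟨hrm, ⟨Cg, hrb⟩, hrg, hrz, -⟩ := Dirichlet.ratio_multiplier hΩ' hφ' hc' hcle'
  have hratio : IsPhys (fun U' : GaugeConfig 3 L' SU2 => φ' U' / Ω' U') := ⟨hrm, ⟨Cg, hrb⟩, hrg, hrz⟩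
  -- its translation-averaged thinning pull-back is physical on the fine torus, bridged to the inline form of the item
  have havg := Thinning.isPhys_avg_thin_shift (G := SU2) hLL h2 hratio
  simp only [torusConfigShift_eq_pinnedInline, thin_eq_pinnedInline] at havg
  obtain ⟨Cf, hCf⟩ := havg.bounded
  have hw := IsPhys.mul_of_invariant hΩ havg.measurable hCf havg.gaugeInv havg.zeroFlux
  -- the door argument (as in `UpStep.upStepAt_of_moments`) on THIS ground state, trial vector `v = w − ⟨w,Ω⟩Ω`
  have door : ∀ w : GaugeConfig 3 L SU2 → ℝ, IsPhys w → l2 w Ω ^ 2 < l2 w w →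
      secondValue su2Rep L' β' ^ L' * topValue su2Rep L β ^ L * (l2 w w - l2 w Ω ^ 2) ≤
        Real.exp s * (topValue su2Rep L' β' ^ L' * (l2 w ((transferApply β)^[L] w) - topValue su2Rep L β ^ L * l2 w Ω ^ 2)) →
      secondValue su2Rep L' β' ^ L' * topValue su2Rep L β ^ L ≤
        Real.exp s * (secondValue su2Rep L β ^ L * topValue su2Rep L' β' ^ L') := by
    intro w hw' hvar' hineq'
    obtain ⟨hv, hvorth, hnorm, htwo⟩ := UpStep.recentred_moments β hΩ hΩ1 hΩeig hw' L
    set v : GaugeConfig 3 L SU2 → ℝ := w + (-(l2 w Ω)) • Ω with hvdef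
    have hvpos : 0 < l2 v v := by rw [hnorm]; linarith
    have hcmp : secondValue su2Rep L' β' ^ L' * topValue su2Rep L β ^ L * l2 v v ≤
        Real.exp s * (topValue su2Rep L' β' ^ L' * l2 v ((transferApply β)^[L] v)) := by
      rw [hnorm, htwo]; exact hineq'
    have hvarb := UpStep.l2_iterate_le_pow_secondValue hβ0 hΩ hΩ1 hΩeig hv hvorth hL1
    have hb' : 0 ≤ topValue su2Rep L' β' ^ L' := pow_nonneg (topValue_su2Rep_pos L' β').le _
    have h1 : Real.exp s * (topValue su2Rep L' β' ^ L' * l2 v ((transferApply β)^[L] v)) ≤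
        Real.exp s * (topValue su2Rep L' β' ^ L' * (secondValue su2Rep L β ^ L * l2 v v)) :=
      mul_le_mul_of_nonneg_left (mul_le_mul_of_nonneg_left hvarb hb') (Real.exp_pos _).le
    have h2' := hcmp.trans h1
    have h3 : (secondValue su2Rep L' β' ^ L' * topValue su2Rep L β ^ L) * l2 v v ≤
        (Real.exp s * (secondValue su2Rep L β ^ L * topValue su2Rep L' β' ^ L')) * l2 v v := by
      calc (secondValue su2Rep L' β' ^ L' * topValue su2Rep L β ^ L) * l2 v v
          = secondValue su2Rep L' β' ^ L' * topValue su2Rep L β ^ L * l2 v v := by ring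
        _ ≤ Real.exp s * (topValue su2Rep L' β' ^ L' * (secondValue su2Rep L β ^ L * l2 v v)) := h2'
        _ = (Real.exp s * (secondValue su2Rep L β ^ L * topValue su2Rep L' β' ^ L')) * l2 v v := by ring
    exact le_of_mul_le_mul_right h3 hvpos
  exact door _ hw hvar hineq

end Summit.QuantumFields.YangMills.Theorems.FemtoCutoffLadder

end
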